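import Literature.Topology.FourManifolds.KirbyMovesSlideSweepExchange2
import Literature.Topology.FourManifolds.IsotopyFromTrajectories
import HarnessLib

/-!
# The handle-slide sweep, planar part V: the exchange fixes the half planes at all radii

Topic `Literature/Topology/FourManifolds`; fact seat `provefact-IsStrictHandleSlide.isSurgery`
(R. C. Kirby, *The Topology of 4-Manifolds*, LNM 1374 (1989), Ch. I §4, Figs. 4.2–4.3 and §5
Thm. 5.1 (1); remaining content: the named fact (S)
`Literature.Topology.FourManifolds.FramedLink.IsStrictHandleSlide.slideModel`). A strengthening
of `SlideSweep.exists_planarSweep` (`KirbyMovesSlideSweepExchange2.lean`) needed by the slide: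
the common stubs of the slid circle and of the finger leave the sweep disc *radially*, across the
annulus `ρ ≤ ‖p‖ ≤ ρ + m` in which the planar isotopy is cut off, so the isotopy must fix the
twisted half planes `{|y| ≥ Y}` there too. This holds for the construction because the
horizontal push is the flow of the field `T′(s) d(z₁) e₀` cut off in time and space, and that
field vanishes identically at every `z` with `d (z₁) = 0`, in particular for `|z₁| ≥ Y`
(`exists_ambientIsotopy_of_hasDerivAt_fix`, `IsotopyFromTrajectories.lean`: the flow fixes the
zeros of the field):

* `SlideSweep.exists_ambientIsotopy_horizontalPush_fix` — the supported horizontal push with the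
  extra clause `G t z = z` whenever `d (z 1) = 0`;
* `SlideSweep.exists_planarSweep_fix` — `exists_planarSweep` with the extra clause
  `σ t (Λ⁻¹ w) = Λ⁻¹ w` for all `w` with `Y ≤ |w 1|` and all `t`.

## References

* R. C. Kirby, *The Topology of 4-Manifolds*, LNM 1374, Springer (1989), Ch. I §4, §5 Thm. 5.1.
  [Kirby1989]
* M. W. Hirsch, *Differential Topology*, GTM 33, Springer (1976), Ch. 8 §1. [HirschDT1976]
-/

open scoped Manifold ContDiff Topology
open Function Set Metric

noncomputable section

namespace Literature.Topology.FourManifolds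

namespace SlideSweep

/-- **The supported horizontal push, fixing the zero set of the displacement.** As
`exists_ambientIsotopy_horizontalPush_of_subset`, and moreover `G t z = z` for every `z` with
`d (z 1) = 0` and every `t`. [cite: HirschDT1976, Ch. 8 §1] -/
theorem exists_ambientIsotopy_horizontalPush_fix {d : ℝ → ℝ} (hd : ContDiff ℝ ∞ d)
    {S K U : Set (EuclideanSpace ℝ (Fin 2))} (hK : IsCompact K) (hU : IsOpen U) (hKU : K ⊆ U)
    (hS : ∀ z ∈ S, ∀ θ ∈ Icc (0 : ℝ) 1, z + (θ * d (z 1)) • EuclideanSpace.single 0 1 ∈ K) :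
    ∃ G : AmbientIsotopy 𝓘(ℝ, EuclideanSpace ℝ (Fin 2)) (EuclideanSpace ℝ (Fin 2)),
      (∃ C : Set (EuclideanSpace ℝ (Fin 2)), IsCompact C ∧ C ⊆ U ∧ ∀ t, ∀ z ∉ C, G.toFun t z = z) ∧
      (∀ z ∈ S, ∀ t ∈ Icc (0 : ℝ) 1,
        G.toFun t z = z + (Real.smoothTransition t * d (z 1)) • EuclideanSpace.single 0 1) ∧
      ∀ z : EuclideanSpace ℝ (Fin 2), d (z 1) = 0 → ∀ t, G.toFun t z = z := by
  set Y : ℝ × EuclideanSpace ℝ (Fin 2) → EuclideanSpace ℝ (Fin 2) :=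
    fun p ↦ (deriv Real.smoothTransition p.1 * d (p.2 1)) • EuclideanSpace.single 0 1 with hY
  have hYs : ContDiff ℝ ∞ Y :=
    ((contDiff_deriv_smoothTransition.comp contDiff_fst).mul
      (hd.comp ((contDiff_apply 1).comp contDiff_snd))).smul contDiff_const
  set c : S → ℝ → EuclideanSpace ℝ (Fin 2) :=
    fun z t ↦ (z : EuclideanSpace ℝ (Fin 2)) +
      (Real.smoothTransition t * d ((z : EuclideanSpace ℝ (Fin 2)) 1)) • EuclideanSpace.single 0 1
    with hc
  have hc1 : ∀ (z : S) (t : ℝ), c z t 1 = (z : EuclideanSpace ℝ (Fin 2)) 1 := fun z t ↦ by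
    simp [c]
  have hderiv : ∀ (z : S), ∀ t ∈ Ioo (-1 : ℝ) 2, HasDerivAt (c z) (Y (t, c z t)) t := by
    intro z t _
    have h1 : HasDerivAt (fun t : ℝ ↦ Real.smoothTransition t * d ((z : EuclideanSpace ℝ (Fin 2)) 1))
        (deriv Real.smoothTransition t * d ((z : EuclideanSpace ℝ (Fin 2)) 1)) t :=
      (((Real.smoothTransition.contDiff (n := 1)).differentiable one_ne_zero) t).hasDerivAt.mul_const _
    have h2 := (h1.smul_const (EuclideanSpace.single (0 : Fin 2) (1 : ℝ))).const_add
      (z : EuclideanSpace ℝ (Fin 2))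
    have hY' : Y (t, c z t) =
        (deriv Real.smoothTransition t * d ((z : EuclideanSpace ℝ (Fin 2)) 1)) •
          EuclideanSpace.single 0 1 := by
      simp only [hY, hc1]
    rw [hY']
    exact h2
  have htrack : ∀ (z : S), ∀ t ∈ Ioo (-1 : ℝ) 2, c z t ∈ K := fun z t _ ↦
    hS z z.2 (Real.smoothTransition t) ⟨Real.smoothTransition.nonneg t, Real.smoothTransition.le_one t⟩
  obtain ⟨G, hGC, hGc, hGfix⟩ := exists_ambientIsotopy_of_hasDerivAt_fix hYs hderiv hK hU hKU htrack
  refine ⟨G, hGC, fun z hz t ht ↦ ?_, fun z hz t ↦ hGfix z (fun s ↦ by simp [hY, hz]) t⟩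
  have h0 : c ⟨z, hz⟩ 0 = z := by simp [c, Real.smoothTransition.zero]
  have := hGc ⟨z, hz⟩ t ht
  rw [h0] at this
  simpa [c] using this

/-- **The planar sweep, fixing the half planes at all radii.** See the module docstring.
[cite: Kirby1989, Ch. I §4] -/
theorem exists_planarSweep_fix (c : ℝ) {Y ρ m : ℝ} (hY : 0 ≤ Y) (hYρ : Y ≤ ρ) (hm : 0 < m) {g₁ g₂ : ℝ → ℝ}
    (hg₁ : ContDiff ℝ ∞ g₁) (hg₂ : ContDiff ℝ ∞ g₂) (heq : ∀ y, Y ≤ |y| → g₁ y = g₂ y)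
    (hbound : ∀ y, |y| ≤ Y → ∀ θ ∈ Icc (0 : ℝ) 1,
      (g₂ y + θ * (g₁ y - g₂ y)) ^ 2 + y ^ 2 ≤ ρ ^ 2) :
    ∃ (Λ : EuclideanSpace ℝ (Fin 2) ≃ₘ⟮𝓘(ℝ, EuclideanSpace ℝ (Fin 2)), 𝓘(ℝ, EuclideanSpace ℝ (Fin 2))⟯
        EuclideanSpace ℝ (Fin 2))
      (σ : AmbientIsotopy 𝓘(ℝ, EuclideanSpace ℝ (Fin 2)) (EuclideanSpace ℝ (Fin 2))),
      (∀ (r a b : ℝ), 0 ≤ r → r ≤ ρ + 2 * m → a ^ 2 + b ^ 2 = 1 →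
        Λ ((r * a) • EuclideanSpace.single 0 1 + (r * b) • EuclideanSpace.single 1 1) =
          (r * (((1 + a) - Real.exp (c * r) ^ 2 * (1 - a)) /
              ((1 + a) + Real.exp (c * r) ^ 2 * (1 - a)))) • EuclideanSpace.single 0 1 +
          (r * (2 * Real.exp (c * r) * b /
              ((1 + a) + Real.exp (c * r) ^ 2 * (1 - a)))) • EuclideanSpace.single 1 1) ∧
      (∀ (r a b : ℝ), 0 ≤ r → r ≤ ρ + 2 * m → a ^ 2 + b ^ 2 = 1 →
        Λ.symm ((r * a) • EuclideanSpace.single 0 1 + (r * b) • EuclideanSpace.single 1 1) =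
          (r * (((1 + a) - Real.exp (-(c * r)) ^ 2 * (1 - a)) /
              ((1 + a) + Real.exp (-(c * r)) ^ 2 * (1 - a)))) • EuclideanSpace.single 0 1 +
          (r * (2 * Real.exp (-(c * r)) * b /
              ((1 + a) + Real.exp (-(c * r)) ^ 2 * (1 - a)))) • EuclideanSpace.single 1 1) ∧
      (∀ z : EuclideanSpace ℝ (Fin 2), ‖z‖ ≤ ρ + 2 * m → ‖Λ z‖ = ‖z‖ ∧ ‖Λ.symm z‖ = ‖z‖) ∧
      (∀ t (z : EuclideanSpace ℝ (Fin 2)), ρ + m ≤ ‖z‖ → σ.toFun t z = z) ∧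
      (∀ y : ℝ, |y| ≤ Y →
        σ.toFun 1 (Λ.symm (g₂ y • EuclideanSpace.single 0 1 + y • EuclideanSpace.single 1 1)) =
          Λ.symm (g₁ y • EuclideanSpace.single 0 1 + y • EuclideanSpace.single 1 1)) ∧
      (∀ w : EuclideanSpace ℝ (Fin 2), Y ≤ |w 1| → ‖w‖ ≤ ρ →
        ∀ t ∈ Icc (0 : ℝ) 1, σ.toFun t (Λ.symm w) = Λ.symm w) ∧
      (∀ w : EuclideanSpace ℝ (Fin 2), Y ≤ |w 1| → ∀ t, σ.toFun t (Λ.symm w) = Λ.symm w) := by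
  set E0 : EuclideanSpace ℝ (Fin 2) := EuclideanSpace.single 0 1 with hE0
  set E1 : EuclideanSpace ℝ (Fin 2) := EuclideanSpace.single 1 1 with hE1
  have hρ0 : 0 ≤ ρ := hY.trans hYρ
  obtain ⟨Λ, hfwd, hbwd, hnorm⟩ := exists_twistDiffeomorph c (ρ + 2 * m)
  -- the displacement
  set d : ℝ → ℝ := fun y ↦ g₁ y - g₂ y with hd
  have hds : ContDiff ℝ ∞ d := hg₁.sub hg₂
  have hd0 : ∀ y, Y ≤ |y| → d y = 0 := fun y hy ↦ by simp only [hd, heq y hy, sub_self]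
  -- starting points: the graph of `g₂` and the two half planes inside the disc
  set S : Set (EuclideanSpace ℝ (Fin 2)) :=
    {z | (|z 1| ≤ Y ∧ z 0 = g₂ (z 1)) ∨ (Y ≤ |z 1| ∧ ‖z‖ ≤ ρ)} with hS
  have hK : IsCompact (closedBall (0 : EuclideanSpace ℝ (Fin 2)) ρ) := isCompact_closedBall _ _
  have hKU : closedBall (0 : EuclideanSpace ℝ (Fin 2)) ρ ⊆ ball 0 (ρ + m) :=
    closedBall_subset_ball (by linarith)
  -- the tracks stay in the disc of radius `ρ`
  have htrack : ∀ z ∈ S, ∀ θ ∈ Icc (0 : ℝ) 1,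
      z + (θ * d (z 1)) • E0 ∈ closedBall (0 : EuclideanSpace ℝ (Fin 2)) ρ := by
    intro z hz θ hθ
    have hzdec : z = (z 0) • E0 + (z 1) • E1 := by
      ext i; fin_cases i <;> simp [E0, E1]
    set x : ℝ := z 0 with hxdef
    set y : ℝ := z 1 with hydef
    rw [mem_closedBall_zero_iff, hzdec]
    rcases hz with ⟨hy, hx⟩ | ⟨hy, hzn⟩
    · rw [← hxdef, ← hydef] at hx
      rw [← hydef] at hy
      have heq' : x • E0 + y • E1 + (θ * d y) • E0 = (g₂ y + θ * (g₁ y - g₂ y)) • E0 + y • E1 := by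
        rw [hx]
        simp only [hd]
        rw [add_smul]
        abel
      rw [heq', norm_smul_single_add_smul_single]
      calc Real.sqrt ((g₂ y + θ * (g₁ y - g₂ y)) ^ 2 + y ^ 2)
          ≤ Real.sqrt (ρ ^ 2) := Real.sqrt_le_sqrt (hbound y hy θ hθ)
        _ = ρ := Real.sqrt_sq hρ0
    · rw [← hydef] at hy
      rw [hd0 y hy, mul_zero, zero_smul, add_zero, ← hzdec]
      exact hzn
  obtain ⟨G, ⟨C, hC, hCU, hGC⟩, hG, hGfix0⟩ :=
    exists_ambientIsotopy_horizontalPush_fix hds hK isOpen_ball hKU htrack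
  -- stationarity of the push off the disc of radius `ρ + m`
  have hGfix : ∀ t (z : EuclideanSpace ℝ (Fin 2)), ρ + m ≤ ‖z‖ → G.toFun t z = z := by
    intro t z hz
    refine hGC t z fun hzC ↦ ?_
    have := hCU hzC
    rw [mem_ball_zero_iff] at this
    linarith
  refine ⟨Λ, G.transfer Λ.symm, hfwd, hbwd, hnorm, ?_, ?_, ?_, ?_⟩
  · intro t z hz
    exact transfer_eq_self_of_norm_le (by linarith) hnorm hGfix t z hz
  · intro y hy
    rw [transfer_symm_apply]
    congr 1
    have hmem : g₂ y • E0 + y • E1 ∈ S := by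
      left
      exact ⟨by simpa [E0, E1] using hy, by simp [E0, E1]⟩
    rw [horizontalPush_one hG hmem]
    have h1 : (g₂ y • E0 + y • E1) 1 = y := by simp [E0, E1]
    rw [h1]
    simp only [hd]
    rw [show g₁ y • E0 + y • E1 = g₂ y • E0 + y • E1 + (g₁ y - g₂ y) • E0 by
      rw [sub_smul]; abel]
  · intro w hw hwn t ht
    rw [transfer_symm_apply]
    congr 1
    have hmem : w ∈ S := Or.inr ⟨hw, hwn⟩
    rw [hG w hmem t ht, hd0 (w 1) hw, mul_zero, zero_smul, add_zero]
  · intro w hw t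
    rw [transfer_symm_apply]
    congr 1
    exact hGfix0 w (hd0 (w 1) hw) t

end SlideSweep

end Literature.Topology.FourManifolds
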